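import Summits.AtomisticToContinuum.BoseEinsteinCondensation.Theses.BECGroundStateSOS
import Summits.AtomisticToContinuum.BoseEinsteinCondensation.Theorems.LatticeODLROOffHalfFilling.Negative.OffHalfFillingForced
import Summits.AtomisticToContinuum.BoseEinsteinCondensation.Theorems.BECGroundStateSOSLatticeODLROOffHalfFillingStubTrialEnergy
import Summits.AtomisticToContinuum.BoseEinsteinCondensation.Theorems.BECGroundStateSOSLatticeODLROOffHalfFillingStubKineticBound

/-!
# Crux `LatticeODLROOffHalfFilling` — the ladder line: glue lemmas

Route BECGroundStateSOS, crux stmt-AtomisticToContinuum-11033, line `Sketch` (lead prover). Glue for the reduction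
file `BECGroundStateSOSLatticeODLROOffHalfFillingOfConcave.lean`: quadratic-form scaling (`quad_smul`, `normSq_smul`,
`re_quad_eq_ratio_mul`), positivity of the planar moment `O = Σ_{x,y}(S¹_xS¹_y + S²_xS²_y) = (S¹_tot)² + (S²_tot)²`
(`re_quad_sumHop_nonneg`), the columns of `P₀(H_{L,μ})` as `S³_tot`-eigen ground vectors (`col_facts`), the SECTOR
WINDOW `|M| ≤ (3/10)L³` for `|μ| ≤ ½` from the landed stubs `stub_trialEnergy` and `stub_kineticBound`
(`sector_window`), sector membership as an eigen-equation (`mem_spinZSector_iff`), and the a-priori bound `≤ ½` on the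
crux's liminf terms (`orderParam_le_half`). All [folklore].
-/

noncomputable section

namespace Summit.AtomisticToContinuum.BoseEinsteinCondensation.Theorems.LatticeODLROOffHalfFilling.Ladder

open Literature.MathematicalPhysics.QuantumLattice Literature.Probability.LatticeModels Matrix Finset
open Summit.AtomisticToContinuum.BoseEinsteinCondensation.Theorems.LatticeODLROOffHalfFilling.Negative
open scoped ComplexOrder BigOperators


/-! ### Glue -/

section Glue

variable {Λ : Type*} [Fintype Λ] [DecidableEq Λ]

/-- Norms of nonzero vectors are positive. [folklore] -/
theorem normSq_pos_of_ne_zero {m : Type*} [Fintype m] {φ : m → ℂ} (hφ : φ ≠ 0) :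
    0 < (star φ ⬝ᵥ φ).re := by
  have hnn : 0 ≤ (star φ ⬝ᵥ φ).re := (Complex.nonneg_iff.mp (dotProduct_star_self_nonneg φ)).1
  rcases hnn.lt_or_eq with hlt | heq
  · exact hlt
  · exfalso
    apply hφ
    apply dotProduct_star_self_eq_zero.mp
    rw [star_dotProduct_self_eq_ofReal, ← heq]
    simp

/-- Quadratic forms scale by `|c|²`. [folklore] -/
theorem quad_smul {m : Type*} [Fintype m] (T : Matrix m m ℂ) (c : ℂ) (ψ : m → ℂ) :
    star (c • ψ) ⬝ᵥ T *ᵥ (c • ψ) = (Complex.normSq c : ℂ) * (star ψ ⬝ᵥ T *ᵥ ψ) := by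
  rw [mulVec_smul, dotProduct_smul, star_smul, smul_dotProduct, smul_eq_mul, smul_eq_mul,
    ← mul_assoc, Complex.star_def, Complex.normSq_eq_conj_mul_self]
  ring

/-- Norms scale by `|c|²`. [folklore] -/
theorem normSq_smul {m : Type*} [Fintype m] (c : ℂ) (ψ : m → ℂ) :
    star (c • ψ) ⬝ᵥ (c • ψ) = (Complex.normSq c : ℂ) * (star ψ ⬝ᵥ ψ) := by
  rw [dotProduct_smul, star_smul, smul_dotProduct, smul_eq_mul, smul_eq_mul,
    ← mul_assoc, Complex.star_def, Complex.normSq_eq_conj_mul_self]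
  ring

/-- The ratio `Re⟨v, Tv⟩ = (Re⟨ψ, Tψ⟩/‖ψ‖²)·‖v‖²` for `v = c • ψ`. [folklore] -/
theorem re_quad_eq_ratio_mul {m : Type*} [Fintype m] (T : Matrix m m ℂ) {c : ℂ} {ψ v : m → ℂ}
    (hψ : ψ ≠ 0) (hv : v = c • ψ) :
    (star v ⬝ᵥ T *ᵥ v).re = (star ψ ⬝ᵥ T *ᵥ ψ).re / (star ψ ⬝ᵥ ψ).re * (star v ⬝ᵥ v).re := by
  have hpos := normSq_pos_of_ne_zero hψ
  rw [hv, quad_smul, normSq_smul, Complex.re_ofReal_mul, Complex.re_ofReal_mul]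
  field_simp

/-- The planar moment is a positive semidefinite form: `Re⟨ψ, O ψ⟩ ≥ 0`,
`O = Σ_{x,y} hop x y = (S¹_tot)² + (S²_tot)²`. [folklore] -/
theorem re_quad_sumHop_nonneg (ψ : TensorIndex Λ 2 → ℂ) :
    0 ≤ (star ψ ⬝ᵥ (∑ x : Λ, ∑ y : Λ, hop x y) *ᵥ ψ).re := by
  have hO : (∑ x : Λ, ∑ y : Λ, hop x y) =
      (∑ x : Λ, siteSpin 1 x 0) * (∑ y : Λ, siteSpin 1 y 0) +
        (∑ x : Λ, siteSpin 1 x 1) * (∑ y : Λ, siteSpin 1 y 1) := by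
    rw [Finset.sum_mul_sum, Finset.sum_mul_sum, ← Finset.sum_add_distrib]
    refine Finset.sum_congr rfl fun x _ => ?_
    rw [← Finset.sum_add_distrib]
    rfl
  have hH : ∀ α : Fin 3, ((∑ x : Λ, siteSpin 1 x α) : Op Λ 2)ᴴ = ∑ x : Λ, siteSpin 1 x α := by
    intro α
    rw [Matrix.conjTranspose_sum]
    exact Finset.sum_congr rfl fun x _ => (siteSpin_isHermitian 1 x α).eq
  rw [hO, add_mulVec, dotProduct_add, Complex.add_re]
  refine add_nonneg ?_ ?_
  · have h := star_dotProduct_conjTranspose_mul_mulVec (∑ x : Λ, siteSpin 1 x 0) ψ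
    rw [hH 0] at h
    rw [h]
    exact (Complex.nonneg_iff.mp (dotProduct_star_self_nonneg _)).1
  · have h := star_dotProduct_conjTranspose_mul_mulVec (∑ x : Λ, siteSpin 1 x 1) ψ
    rw [hH 1] at h
    rw [h]
    exact (Complex.nonneg_iff.mp (dotProduct_star_self_nonneg _)).1

variable (L : ℕ) [NeZero L]

/-- The columns of `P₀(H_{L,μ})` are ground vectors and `S³_tot`-eigenvectors with eigenvalue
`|Λ|/2 − #↓σ` (`P₀` commutes with `S³_tot`). [folklore] -/
theorem col_facts (hL : 3 ≤ L) (μ : ℝ) (σ : TensorIndex (TorusSite 3 L) 2) :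
    (Hmu L μ).groundProj.col σ ∈ (Hmu L μ).groundSpace ∧
      (totalSpin 1 2 : Op (TorusSite 3 L) 2) *ᵥ (Hmu L μ).groundProj.col σ =
        ((((L : ℝ) ^ 3 / 2 - (downCount σ : ℝ)) : ℝ) : ℂ) • (Hmu L μ).groundProj.col σ := by
  refine ⟨groundProj_col_mem _ σ, ?_⟩
  have hc : (totalSpin 1 2 : Op (TorusSite 3 L) 2) * Hmu L μ = Hmu L μ * totalSpin 1 2 :=
    (commute_hmu_totalSpin_two L hL μ).symm.eq
  have hP := groundProj_commute_of_commute (Hmu_isHermitian L μ) hc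
  rw [← mulVec_single_one, mulVec_mulVec, ← hP, ← mulVec_mulVec, totalSpin_two_mulVec_single,
    mulVec_smul]
  congr 1
  have hcard : Fintype.card (TorusSite 3 L) = L ^ 3 := by simp [ZMod.card, Fintype.card_fin]
  rw [hcard]
  push_cast
  ring

/-- **The sector window.** For `|μ| ≤ ½` and `L ≥ 3`, every nonzero `S³_tot`-eigen ground vector of
`H_{L,μ}` has `|M| ≤ (3/10) L³` (`stub_trialEnergy`, `stub_kineticBound`, Rayleigh). [folklore] -/
theorem sector_window (L : ℕ) [NeZero L] (hL : 3 ≤ L) {μ : ℝ} (hμ : |μ| ≤ 1 / 2) {M : ℝ}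
    {v : TensorIndex (TorusSite 3 L) 2 → ℂ} (hv : v ∈ (Hmu L μ).groundSpace)
    (hS : (totalSpin 1 2 : Op (TorusSite 3 L) 2) *ᵥ v = (M : ℂ) • v) (hv0 : v ≠ 0) :
    |M| ≤ 3 / 10 * (L : ℝ) ^ 3 := by
  have hkin := stub_kineticBound L hL M v hS
  have htrial := stub_trialEnergy L hL μ
  have npos := normSq_pos_of_ne_zero hv0
  set n : ℝ := (star v ⬝ᵥ v).re with hn
  -- the eigenvalue equation gives `Re⟨v, Hμ v⟩ = E₀ ‖v‖²`
  have hE : (star v ⬝ᵥ (Hmu L μ) *ᵥ v).re = (Hmu L μ).groundEnergy * n := by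
    rw [(mem_groundSpace_iff _ v).mp hv, dotProduct_smul, smul_eq_mul, Complex.re_ofReal_mul]
  -- `Hμ v = H₀ v − μ M v`
  have hsplit : (star v ⬝ᵥ (Hmu L μ) *ᵥ v).re =
      (star v ⬝ᵥ (xyTorus 3 L 1) *ᵥ v).re - μ * M * n := by
    rw [Hmu, sub_mulVec, smul_mulVec, hS, smul_smul, dotProduct_sub, dotProduct_smul,
      smul_eq_mul, Complex.sub_re, ← Complex.ofReal_mul, Complex.re_ofReal_mul]
  have h1 : (Hmu L μ).groundEnergy * n ≤ -(3 / 4 * (L : ℝ) ^ 3) * n :=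
    mul_le_mul_of_nonneg_right htrial npos.le
  -- combine: `3|M| − |μ||M| ≤ ¾ L³` (all linear in the atoms `|M| n`, `|μ||M| n`, `μ M n`, `L³ n`)
  have hC : μ * M * n ≤ |μ| * |M| * n := by
    rw [← abs_mul]
    exact mul_le_mul_of_nonneg_right (le_abs_self _) npos.le
  have e1 : -(3 * ((L : ℝ) ^ 3 / 2 - |M|)) * n = -(3 / 2) * ((L : ℝ) ^ 3 * n) + 3 * (|M| * n) := by
    ring
  have e2 : -(3 / 4 * (L : ℝ) ^ 3) * n = -(3 / 4) * ((L : ℝ) ^ 3 * n) := by ring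
  have e3 : |μ| * |M| * n = |μ| * (|M| * n) := by ring
  rw [e1] at hkin
  rw [e2] at h1
  rw [e3] at hC
  have hMn : (5 / 2 : ℝ) * (|M| * n) ≤ 3 / 4 * ((L : ℝ) ^ 3 * n) := by
    have hμ2 : |μ| * (|M| * n) ≤ 1 / 2 * (|M| * n) :=
      mul_le_mul_of_nonneg_right hμ (mul_nonneg (abs_nonneg M) npos.le)
    linarith
  have hfin : (5 / 2 : ℝ) * |M| * n ≤ 3 / 4 * (L : ℝ) ^ 3 * n := by
    have e4 : (5 / 2 : ℝ) * |M| * n = 5 / 2 * (|M| * n) := by ring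
    have e5 : 3 / 4 * (L : ℝ) ^ 3 * n = 3 / 4 * ((L : ℝ) ^ 3 * n) := by ring
    rw [e4, e5]
    exact hMn
  have key' : (5 / 2 : ℝ) * |M| ≤ 3 / 4 * (L : ℝ) ^ 3 := le_of_mul_le_mul_right hfin npos
  linarith

/-- Membership in a magnetisation sector is the eigenvector equation. [folklore] -/
theorem mem_spinZSector_iff (M : ℝ) (v : TensorIndex (TorusSite 3 L) 2 → ℂ) :
    v ∈ spinZSector (Λ := TorusSite 3 L) 1 M ↔
      (totalSpin 1 2 : Op (TorusSite 3 L) 2) *ᵥ v = (M : ℂ) • v := by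
  rw [spinZSector, Module.End.mem_eigenspace_iff, Matrix.toLin'_apply]

/-- Each `liminf` term of the crux is at most `½`: `Re ω(S^α_xS^α_y) ≤ ¼` by positivity of the
tracial ground state and `¼·1 − S^α_xS^α_y ≥ 0`. [folklore] -/
theorem orderParam_le_half (μ : ℝ) (k : ℕ) :
    (∑ x ∈ halfOpenBox 3 (2 * k), ∑ y ∈ halfOpenBox 3 (2 * k),
      torusPullback (d := 3) (fun L x y => if hL : L = 0 then 0 else (haveI : NeZero L := ⟨hL⟩;
        (∑ α : Fin 2, (xxzHamiltonian 1 (torusGraph 3 L) (-1) 0 -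
          (μ : ℂ) • totalSpin 1 2).groundStateFunctional
          (siteSpin 1 x (Fin.castSucc α) * siteSpin 1 y (Fin.castSucc α))).re)) (2 * k) x y) /
      ((halfOpenBox 3 (2 * k)).card : ℝ) ^ 2 ≤ 1 / 2 := by
  rcases Nat.eq_zero_or_pos k with rfl | hk
  · simp
  have hL0 : 2 * k ≠ 0 := by omega
  haveI : NeZero (2 * k) := ⟨hL0⟩
  have hc : (0 : ℝ) ≤ 1 / 2 := by norm_num
  refine div_le_of_le_mul₀ (by positivity) hc ?_
  have hb : ∀ x y : Site 3, torusPullback (d := 3) (fun L x y => if hL : L = 0 then 0 else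
      (haveI : NeZero L := ⟨hL⟩;
        (∑ α : Fin 2, (xxzHamiltonian 1 (torusGraph 3 L) (-1) 0 -
          (μ : ℂ) • totalSpin 1 2).groundStateFunctional
          (siteSpin 1 x (Fin.castSucc α) * siteSpin 1 y (Fin.castSucc α))).re)) (2 * k) x y ≤
      1 / 2 := by
    intro x y
    simp only [torusPullback_apply, dif_neg hL0]
    set s := Torus.proj (2 * k) x
    set t := Torus.proj (2 * k) y
    set H := Hmu (2 * k) μ with hH
    have hHerm : H.IsHermitian := Hmu_isHermitian (2 * k) μ
    have hone : H.groundStateFunctional 1 = 1 := groundStateFunctional_one hHerm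
    have hterm : ∀ α : Fin 3, (H.groundStateFunctional (siteSpin 1 s α * siteSpin 1 t α)).re ≤
        1 / 4 := by
      intro α
      have hup := groundStateFunctional_nonneg_of_posSemidef H
        (posSemidef_sq_smul_one_sub_siteSpin_mul' 1 s t α)
      rw [map_sub, LinearMap.map_smul, hone, smul_eq_mul, mul_one] at hup
      obtain ⟨hup_re, -⟩ := Complex.nonneg_iff.mp hup
      rw [Complex.sub_re] at hup_re
      have h14 : (((1 : ℕ) : ℂ) / 2) ^ 2 = ((1 / 4 : ℝ) : ℂ) := by push_cast; ring
      rw [h14, Complex.ofReal_re] at hup_re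
      linarith
    rw [Complex.re_sum, Fin.sum_univ_two]
    have h0 := hterm (Fin.castSucc 0)
    have h1 := hterm (Fin.castSucc 1)
    change (H.groundStateFunctional _).re + (H.groundStateFunctional _).re ≤ 1 / 2
    linarith
  calc _ ≤ ∑ x ∈ halfOpenBox 3 (2 * k), ∑ y ∈ halfOpenBox 3 (2 * k), (1 / 2 : ℝ) :=
        sum_le_sum fun x _ => sum_le_sum fun y _ => hb x y
    _ = 1 / 2 * ((halfOpenBox 3 (2 * k)).card : ℝ) ^ 2 := by
        simp only [sum_const, nsmul_eq_mul]
        ring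

end Glue

end Summit.AtomisticToContinuum.BoseEinsteinCondensation.Theorems.LatticeODLROOffHalfFilling.Ladder

end
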